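import Literature.NumberTheory.Weil1965.LocalQuadraticFibreDensityDecay
import HarnessLib

/-!
# The unramified Gauss transform: `‖∫_{𝒪^r} ψ(β f)‖ = μ(𝒪)^r · max(1, ‖β‖)^{−r/2}` EXACTLY

Topic `NumberTheory/Weil1965`; namespace `Literature.NumberTheory.Weil1965` (sequel of ★ `LocalQuadraticFibreDensityDecay`,
★ `Weil1964/LocalQuadraticGaussIntegral`, ★ `Weil1964/LocalWeilIndex`).  KERNEL only: proved theorems, no definition, no
named fact, no `sorry`.

At an UNRAMIFIED place — `ψ` of conductor exponent `0`, `‖2‖ = 1` (odd residue characteristic), a DIAGONAL quadratic form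
`f(x) = Σ cᵢ xᵢ²` with UNIT coefficients `‖cᵢ‖ = 1`, and the unramified test function `𝟙_{𝒪^r}` — the Gauss transform
`G(β) = ∫_{𝒪^r} ψ(β f(x)) dx` has the EXACT modulus

  `‖G(β)‖ = μ(𝒪)^r · max(1, ‖β‖)^{−r/2}`   (`r = |ι|`),

with NO implied constant: for `‖β‖ ≤ 1` the integrand is `1` on `𝒪^r` (★ `gaussBall_zero_of_unramified`); for `‖β‖ = q^k > 1`
each one-variable factor is Weil's stable Gauss integral with `|g(βcᵢ, 𝒪)|² = μ(𝒪) μ(𝔭^{−k}) = μ(𝒪)² q^{−k}`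
(★ `norm_sq_gaussBall`, [Weil1964, Chap. I n° 14 Thm 2 Cor. 2; Chap. II n° 27]), and the `r`-variable integral is the product
(★ `integral_indicator_piCoset_mul_psiSqPi`, [Weil1964, Chap. II n° 25 Prop. 3]).

* `norm_gaussBall_zero_of_unramified_of_normAbs_le_one`, `norm_gaussBall_zero_of_unramified_of_one_lt_normAbs`,
  `norm_gaussBall_zero_of_unramified` — one variable: `‖g(a, 𝒪)‖ = μ(𝒪) · max(1, ‖a‖)^{−1/2}` for a UNIT-free `a` (any `a`);
* `norm_integral_indicator_piPrimePowBall_mul_psiSqPi_of_unramified` — `r` variables, unit coefficients: the displayed identity;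
* `norm_integral_indicator_piPrimePowBall_mul_psiSqPi_le_of_unramified` — the same as the bound `≤ μ(𝒪)^r · max(1,‖β‖)^{−r/2}`,
  the ALMOST-EVERYWHERE factor (constant exactly `μ(𝒪_v)^r`, `= 1` for the normalised Haar measure) of the Euler-product majorant
  `Π_v max(1, |b|_v)^{−N}` of the rank-one Siegel–Eisenstein series in Weil's range `N > 2` ([Weil1965, Chap. I n° 2 Prop. 2 and
  n° 40 Thm. 1 (p. 57) and n° 41]) — the companion of the `∃ C` decay of ★ `exists_norm_integral_mul_psiSqPi_le_of_mem_schwartzBruhat` at the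
  finitely many remaining places.

Cell `hodgecm-mathlib`, FLOOR 0, E-2 desk, crux item H413, child line `Cruxes/H413/Lines/F0_E2SiegelWeilWeilRange.lean`, piece «SW2
(unif)» (U2-unr).  HC_CM is proved only modulo the 7 printed citations until rung 0 closes; this file is unconditional.

## References
* [Weil1964] A. Weil, *Sur certains groupes d'opérateurs unitaires*, Acta Math. 111 (1964): Chap. I n° 14 Thm 2 Cor. 2 p. 162;
  Chap. II n° 25 Prop. 3 p. 173, n° 27 pp. 174–175 (the Gauss integrals `g(f, M)` and their moduli).
* [Weil1965] A. Weil, *Sur la formule de Siegel dans la théorie des groupes classiques*, Acta Math. 113 (1965): Chap. I n° 2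
  Prop. 2 p. 8 (decay of `F*_Φ`), n° 40 Thm. 1 (p. 57) and n° 41 (convergence of the Eisenstein–Siegel series).
-/

set_option autoImplicit false

noncomputable section

open MeasureTheory ValuativeRel Filter Topology Set
open scoped NNReal ENNReal Pointwise
open Literature.NumberTheory.GaloisRepresentations.IsNonarchimedeanLocalField
open Literature.NumberTheory.Automorphic
open Literature.NumberTheory.Weil1964

namespace Literature.NumberTheory.Weil1965

variable {F : Type*} [Field F] [ValuativeRel F] [TopologicalSpace F] [IsNonarchimedeanLocalField F]

/-! ## §1 One variable: `‖g(a, 𝒪)‖ = μ(𝒪) · max(1, ‖a‖)^{−1/2}` at an unramified place -/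

section OneVariable

variable [MeasurableSpace F] [BorelSpace F] (μ : Measure F) [μ.IsAddHaarMeasure] {ψ : AddChar F Circle}

omit [μ.IsAddHaarMeasure] in
/-- `‖a‖ ≤ 1`: `g(a, 𝒪) = μ(𝒪)` so `‖g(a, 𝒪)‖ = μ(𝒪)`. [cite: Weil1964, Chap. II n° 27, p. 175] -/
theorem norm_gaussBall_zero_of_unramified_of_normAbs_le_one (hd : ψ.HasConductorExp 0) {a : F}
    (ha : normAbs F a ≤ 1) : ‖gaussBall ψ μ a 0‖ = μ.real (primePowBall F 0) := by
  rw [gaussBall_zero_of_unramified μ hd ha, Complex.norm_real, Real.norm_of_nonneg measureReal_nonneg]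

/-- `‖a‖ = q^k > 1` (`k ≥ 1`), `‖2‖ = 1`: `‖g(a, 𝒪)‖² = μ(𝒪)² · ‖a‖⁻¹` (the stable range `0 ≤ 0 − (−k) − 0` of
★ `norm_sq_gaussBall`, and `μ(𝔭^{−k}) = q^{k} μ(𝒪)`). [cite: Weil1964, Chap. I n° 14 Thm 2 Cor. 2, p. 162; Chap. II n° 27, p. 175] -/
theorem norm_gaussBall_zero_sq_of_unramified (hd : ψ.HasConductorExp 0) (h2 : normAbs F (2 : F) = 1) {a : F} {v : ℤ}
    (ha : normAbs F a = (residueFieldCard F : ℝ≥0)⁻¹ ^ v) (hv : v ≤ 0) :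
    ‖gaussBall ψ μ a 0‖ ^ 2 = μ.real (primePowBall F 0) ^ 2 * ((normAbs F a : ℝ≥0) : ℝ)⁻¹ := by
  have h2' : normAbs F (2 : F) = (residueFieldCard F : ℝ≥0)⁻¹ ^ (0 : ℤ) := by rw [zpow_zero, h2]
  have hq : (residueFieldCard F : ℝ) ≠ 0 := Nat.cast_ne_zero.2 (residueFieldCard_ne_zero F)
  rw [norm_sq_gaussBall μ hd ha h2' (n := 0) (by omega), ha]
  push_cast
  simp only [zero_sub, sub_zero]
  rw [LocalFieldHaar.measureReal_primePowBall μ (-v), zpow_neg]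
  ring

/-- `‖a‖ > 1`, `‖2‖ = 1`: `‖g(a, 𝒪)‖ = μ(𝒪) · ‖a‖^{−1/2}`. [cite: Weil1964, Chap. I n° 14 Thm 2 Cor. 2, p. 162; Chap. II n° 27, p. 175] -/
theorem norm_gaussBall_zero_of_unramified_of_one_lt_normAbs (hd : ψ.HasConductorExp 0) (h2 : normAbs F (2 : F) = 1)
    {a : F} (ha : 1 < normAbs F a) :
    ‖gaussBall ψ μ a 0‖ = μ.real (primePowBall F 0) * ((normAbs F a : ℝ≥0) : ℝ) ^ (-(1 / 2 : ℝ)) := by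
  have ha0 : a ≠ 0 := by
    rintro rfl
    rw [map_zero] at ha
    exact not_lt.2 zero_le_one ha
  obtain ⟨v, hv⟩ := exists_normAbs_eq_inv_zpow ha0
  have hvle : v ≤ 0 := by
    by_contra h
    push Not at h
    have hq1 : (1 : ℝ≥0) < residueFieldCard F := by exact_mod_cast one_lt_residueFieldCard F
    have : normAbs F a < 1 := by
      rw [hv, inv_zpow']
      exact zpow_lt_one_of_neg₀ hq1 (by omega)
    exact lt_asymm ha this
  have hsq := norm_gaussBall_zero_sq_of_unramified μ hd h2 hv hvle
  have hapos : (0 : ℝ) < ((normAbs F a : ℝ≥0) : ℝ) := by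
    have : (0 : ℝ≥0) < normAbs F a := lt_trans zero_lt_one ha
    exact_mod_cast this
  have hrhs_nonneg : 0 ≤ μ.real (primePowBall F 0) * ((normAbs F a : ℝ≥0) : ℝ) ^ (-(1 / 2 : ℝ)) :=
    mul_nonneg measureReal_nonneg (Real.rpow_nonneg hapos.le _)
  have hrhs_sq : (μ.real (primePowBall F 0) * ((normAbs F a : ℝ≥0) : ℝ) ^ (-(1 / 2 : ℝ))) ^ 2 =
      μ.real (primePowBall F 0) ^ 2 * ((normAbs F a : ℝ≥0) : ℝ)⁻¹ := by
    have hexp : (-(1 / 2 : ℝ)) * ((2 : ℕ) : ℝ) = -1 := by norm_num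
    rw [mul_pow, ← Real.rpow_natCast (((normAbs F a : ℝ≥0) : ℝ) ^ (-(1 / 2 : ℝ))) 2, ← Real.rpow_mul hapos.le, hexp,
      Real.rpow_neg_one]
  exact (sq_eq_sq₀ (norm_nonneg _) hrhs_nonneg).1 (hsq.trans hrhs_sq.symm)

/-- **`‖g(a, 𝒪)‖ = μ(𝒪) · max(1, ‖a‖)^{−1/2}`** for every `a` at an unramified place (`ψ` of conductor exponent `0`, `‖2‖ = 1`).
[cite: Weil1964, Chap. I n° 14 Thm 2 Cor. 2, p. 162; Chap. II n° 27, p. 175] -/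
theorem norm_gaussBall_zero_of_unramified (hd : ψ.HasConductorExp 0) (h2 : normAbs F (2 : F) = 1) (a : F) :
    ‖gaussBall ψ μ a 0‖ = μ.real (primePowBall F 0) * ((max 1 (normAbs F a) : ℝ≥0) : ℝ) ^ (-(1 / 2 : ℝ)) := by
  rcases le_or_gt (normAbs F a) 1 with ha | ha
  · rw [norm_gaussBall_zero_of_unramified_of_normAbs_le_one μ hd ha, max_eq_left ha, NNReal.coe_one, Real.one_rpow,
      mul_one]
  · rw [norm_gaussBall_zero_of_unramified_of_one_lt_normAbs μ hd h2 ha, max_eq_right ha.le]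

end OneVariable

/-! ## §2 `r` variables with unit coefficients: `‖∫_{𝒪^r} ψ(β f)‖ = μ(𝒪)^r · max(1, ‖β‖)^{−r/2}` -/

section SeveralVariables

variable {ι : Type*} [Fintype ι]
variable [MeasurableSpace F] [BorelSpace F] (μ : Measure F) [μ.IsAddHaarMeasure] {ψ : AddChar F Circle}

omit [MeasurableSpace F] [BorelSpace F] in
/-- a unit coefficient does not change the modulus: `max(1, ‖β c‖) = max(1, ‖β‖)` for `‖c‖ = 1`. [folklore] -/
private theorem max_one_normAbs_mul_of_normAbs_eq_one (β : F) {c : F} (hc : normAbs F c = 1) :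
    max 1 (normAbs F (β * c)) = max 1 (normAbs F β) := by
  rw [map_mul, hc, mul_one]

/-- **THE UNRAMIFIED GAUSS TRANSFORM, EXACTLY**: for `ψ` of conductor exponent `0`, `‖2‖ = 1` and unit coefficients `‖cᵢ‖ = 1`,
`‖∫ 𝟙_{𝒪^r}(x) ψ(β Σ cᵢ xᵢ²) dμ^{⊗r}‖ = μ(𝒪)^r · max(1, ‖β‖)^{−r/2}` for EVERY `β ∈ F` (`r = |ι|`).
[cite: Weil1964, Chap. II n° 25 Prop. 3, p. 173 and n° 27, p. 175] [cite: Weil1965, Chap. I n° 2 Prop. 2, p. 8] -/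
theorem norm_integral_indicator_piPrimePowBall_mul_psiSqPi_of_unramified (hd : ψ.HasConductorExp 0)
    (h2 : normAbs F (2 : F) = 1) {c : ι → F} (hc : ∀ i, normAbs F (c i) = 1) (β : F) :
    ‖∫ x, (piCoset F (fun _ : ι => (0 : F)) 0).indicator (fun _ => (1 : ℂ)) x * psiSqPi ψ (fun i => β * c i) x
        ∂(Measure.pi fun _ : ι => μ)‖ =
      μ.real (primePowBall F 0) ^ Fintype.card ι *
        ((max 1 (normAbs F β) : ℝ≥0) : ℝ) ^ (-((Fintype.card ι : ℝ) / 2)) := by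
  rw [integral_indicator_piCoset_mul_psiSqPi μ c (fun _ : ι => (0 : F)) 0 β, norm_prod]
  have hfac : ∀ i, ‖∫ x in (0 : F) +ᵥ primePowBall F 0, psiSq ψ (β * c i) x ∂μ‖ =
      μ.real (primePowBall F 0) * ((max 1 (normAbs F β) : ℝ≥0) : ℝ) ^ (-(1 / 2 : ℝ)) := by
    intro i
    rw [setIntegral_vadd_primePowBall_psiSq_eq_gaussBall_of_mem μ (zero_mem_primePowBall 0),
      norm_gaussBall_zero_of_unramified μ hd h2, max_one_normAbs_mul_of_normAbs_eq_one β (hc i)]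
  simp_rw [hfac]
  rw [Finset.prod_const, Finset.card_univ, mul_pow, ← Real.rpow_natCast (((max 1 (normAbs F β) : ℝ≥0) : ℝ) ^ _),
    ← Real.rpow_mul (NNReal.coe_nonneg _)]
  congr 2
  ring

/-- **The almost-everywhere Euler factor**: `‖∫_{𝒪^r} ψ(β f)‖ ≤ μ(𝒪)^r · max(1, ‖β‖)^{−r/2}` (constant EXACTLY `μ(𝒪)^r`) at
every unramified place. [cite: Weil1965, Chap. I n° 2 Prop. 2, p. 8 and n° 40 Thm. 1 (p. 57)] -/
theorem norm_integral_indicator_piPrimePowBall_mul_psiSqPi_le_of_unramified (hd : ψ.HasConductorExp 0)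
    (h2 : normAbs F (2 : F) = 1) {c : ι → F} (hc : ∀ i, normAbs F (c i) = 1) (β : F) :
    ‖∫ x, (piCoset F (fun _ : ι => (0 : F)) 0).indicator (fun _ => (1 : ℂ)) x * psiSqPi ψ (fun i => β * c i) x
        ∂(Measure.pi fun _ : ι => μ)‖ ≤
      μ.real (primePowBall F 0) ^ Fintype.card ι *
        ((max 1 (normAbs F β) : ℝ≥0) : ℝ) ^ (-((Fintype.card ι : ℝ) / 2)) :=
  (norm_integral_indicator_piPrimePowBall_mul_psiSqPi_of_unramified μ hd h2 hc β).le

/-- **Normalised form**: if `μ(𝒪) = 1` then `‖∫_{𝒪^r} ψ(β f)‖ = max(1, ‖β‖)^{−r/2}` — the factor `= 1` for `‖β‖ ≤ 1`, i.e. at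
almost every place for a global `β`. [cite: Weil1965, Chap. I n° 2 Prop. 2, p. 8 and n° 40 Thm. 1 (p. 57)] -/
theorem norm_integral_indicator_piPrimePowBall_mul_psiSqPi_of_unramified_of_measureReal_eq_one
    (hd : ψ.HasConductorExp 0) (h2 : normAbs F (2 : F) = 1) {c : ι → F} (hc : ∀ i, normAbs F (c i) = 1)
    (hμ : μ.real (primePowBall F 0) = 1) (β : F) :
    ‖∫ x, (piCoset F (fun _ : ι => (0 : F)) 0).indicator (fun _ => (1 : ℂ)) x * psiSqPi ψ (fun i => β * c i) x
        ∂(Measure.pi fun _ : ι => μ)‖ =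
      ((max 1 (normAbs F β) : ℝ≥0) : ℝ) ^ (-((Fintype.card ι : ℝ) / 2)) := by
  rw [norm_integral_indicator_piPrimePowBall_mul_psiSqPi_of_unramified μ hd h2 hc β, hμ, one_pow, one_mul]

/-- in particular `= 1` when moreover `‖β‖ ≤ 1` (unramified place, unramified datum, integral `β`). [cite: Weil1965, n° 40 Thm. 1 (p. 57)] -/
theorem norm_integral_indicator_piPrimePowBall_mul_psiSqPi_eq_one_of_unramified (hd : ψ.HasConductorExp 0)
    (h2 : normAbs F (2 : F) = 1) {c : ι → F} (hc : ∀ i, normAbs F (c i) = 1) (hμ : μ.real (primePowBall F 0) = 1)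
    {β : F} (hβ : normAbs F β ≤ 1) :
    ‖∫ x, (piCoset F (fun _ : ι => (0 : F)) 0).indicator (fun _ => (1 : ℂ)) x * psiSqPi ψ (fun i => β * c i) x
        ∂(Measure.pi fun _ : ι => μ)‖ = 1 := by
  rw [norm_integral_indicator_piPrimePowBall_mul_psiSqPi_of_unramified_of_measureReal_eq_one μ hd h2 hc hμ β,
    max_eq_left hβ, NNReal.coe_one, Real.one_rpow]

end SeveralVariables

end Literature.NumberTheory.Weil1965

end
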